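/-
Copyright (c) 2026 The HCML crux team. All rights reserved.
Released under Apache 2.0 license as described in the file LICENSE.
Authors: K2E3-p14 (g5) (explicit-unit `hodgecm-mathlib-K2E3-p14-g5`)
-/
import Summits.HodgeConjecture.HodgeConjecture.Theorems.K2E3GL3TruncatedCharSplitTorusRadius   -- ★ (T18-split) p858074 (this seat): `v_mul_apply_le_one`, `v_sub_smul_one_apply_le_one`, …
import Summits.HodgeConjecture.HodgeConjecture.Theorems.K2E3GL2EllipticConjugacyCount          -- ★ (K2E3-p23): `normAbs_discr_mul_max_le` (anisotropy via Hensel)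
import Literature.NumberTheory.Automorphic.ValuedFieldValuativeRelBridge                   -- ★ `v_le_iff_valuation_le`
import HarnessLib

/-!
# (GL-[M6]-sc, T18-mixed, file 1 of 2) The norm form of the companion block: algebra of `γ = diag(C_π, c)` and the anisotropy bound in valuation form

Cell `hodgecm-mathlib`, Track B, line `K2_E3_EllipticInputs`; payer «GL-[M6]-sc» of leaf (11-3-split-sc-NE) (dealer K2E3-plan (g3) D63, line lead K2E3-p23
(g5), RULINGS #13 (M13-1) «T18-mixed», BLUEPRINT v4 §2 route (i)).  Harish-Chandra's Theorem 18 at the MIXED torus `T_E = E^× × F^×` of `GL₃(F)`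
[HarishChandra1970, Part VII §2 Thm 18 + Cor p. 69] for the companion normal form `γ = !![0, −N, 0; 1, T, 0; 0, 0, c]` (`π = X² − TX + N` without a root in
`F`) runs on TWO pieces of algebra, collected here (file 2 `K2E3GL3TruncatedCharMixedTorusRadius` is the estimate itself):
* §1 (any field) THE PROJECTOR: `γ² − Tγ + N = π(c)·E₂₂` (`sq_sub_smul_add_smul_one_eq_diagonal`, Cayley–Hamilton on the block), conjugation
  `π(x γ x⁻¹) = x · π(γ) · x⁻¹` (`conj_sq_sub_smul_add_smul_one`), so `π(y)_{il} = π(c) · x_{i2} (x⁻¹)_{2l}` (`apply_mul_mul_inv_apply_two_eq`); the traces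
  `tr(x γ x⁻¹) = T + c`, `tr adj(x γ x⁻¹) = N + Tc` (`trace_conj_eq`, `trace_adjugate_conj_eq`); THE TORUS ELEMENT `t(u,v) = !![u, −vN, 0; v, u + vT, 0; 0, 0, 1]
  (`= diag(u + v C_π, 1) ∈ Z(γ)`): `blockT_mul_eq_mul_blockT`, `det_blockT`; THE NORM FORM `Q(a,b) = a(bT − aN) − b²`
  (`= det[r ; r C_π]`, `r = (a,b)`), multiplicative under `r ↦ r·(u + v C_π)` with factor `det = u² + uvT + v²N` (`Q_rowAct`), and CRAMER: `u = −b∕Q`, `v = a∕Q` sends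
  `r` to `(0,1)` with `det = −1∕Q` (`rowAct_cramer`, `det_cramer`).
* §2 (`[Valued F ℤᵐ⁰]`) `y = x γ x⁻¹` integral ⇒ `|c|, |T|, |N| ≤ 1` (`v_c_le_one`, `v_T_le_one`, `v_N_le_one`: eigen-column, trace, trace of the adjugate) and
  `|π(c) · x_{i2}(x⁻¹)_{2l}| ≤ 1` (`v_evalc_mul_apply_mul_inv_apply_le_one`).
* §3 (non-archimedean local field) THE ANISOTROPY BOUND IN VALUATION FORM, homogenised from ★ `normAbs_discr_mul_max_le` (Hensel): for `T, N` integral and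
  `π` rootless, **`|T² − 4N| · |a|² ≤ |Q(a,b)|` and `|T² − 4N| · |b|² ≤ |Q(a,b)|`** (`v_discr_mul_sq_le_v_normForm`).

HONEST LABEL: HC_CM is proved only modulo the 7 printed citations (2 remaining named inputs: hLiu418 = stmt-HodgeConjecture-24832, h413 =
stmt-HodgeConjecture-24833) until rung 0 closes; count-neutral (kernel lane `--supports stmt-HodgeConjecture-24833 --as helper`), THEOREMS ONLY — no `def`, no
instance, no notation, no `sorry`.

## References
* [HarishChandra1970] Harish-Chandra (notes by G. van Dijk), *Harmonic Analysis on Reductive p-adic Groups*, LNM 162 (1970), Part VII §2 Thm 18 p. 69, §3 Lemma 46 p. 73.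
* [NeukirchANT1999] J. Neukirch, *Algebraic Number Theory* (1999), Ch. II §4 Lemma (4.6) (Hensel), §5 (the norm form of a quadratic extension).
-/

set_option linter.dupNamespace false

noncomputable section

open Set Function
open scoped MatrixGroups WithZero NNReal
open Matrix
open Literature.NumberTheory.Automorphic Literature.NumberTheory.GaloisRepresentations Literature.NumberTheory.GaloisRepresentations.IsNonarchimedeanLocalField
open Summit.HodgeConjecture.HodgeConjecture.Cruxes.H413.K2E3GL3TruncatedCharSplitTorusRadius

namespace Summit.HodgeConjecture.HodgeConjecture.Cruxes.H413.K2E3GL3MixedTorusNormForm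

/-! ## §1 Algebra of the companion block, the torus element `t(u,v)` and the norm form `Q` -/

section Algebra

variable {F : Type*} [Field F]

/-- **THE PROJECTOR (Cayley–Hamilton on the block)**: for `γ = !![0, −N, 0; 1, T, 0; 0, 0, c]`, `γ² − Tγ + N·1 = π(c)·E₂₂ = diagonal (0, 0, c² − Tc + N)`.
[cite: HarishChandra1970, Part VII §2 Theorem 18 p. 69] -/
theorem sq_sub_smul_add_smul_one_eq_diagonal (T N c : F) :
    !![0, -N, 0; 1, T, 0; 0, 0, c] * !![0, -N, 0; 1, T, 0; 0, 0, c] - T • !![0, -N, 0; 1, T, 0; 0, 0, c] + N • (1 : Matrix (Fin 3) (Fin 3) F) =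
      Matrix.diagonal ![0, 0, c ^ 2 - T * c + N] := by
  ext i j
  fin_cases i <;> fin_cases j <;> simp [Matrix.diagonal] <;> ring

/-- **Conjugation is a ring map**: for `X X' = 1 = X' X`, `(XGX')² − T(XGX') + N·1 = X (G² − TG + N·1) X'`. [folklore] -/
theorem conj_sq_sub_smul_add_smul_one {n : Type*} [Fintype n] [DecidableEq n] (X X' G : Matrix n n F) (hXX' : X * X' = 1) (hX'X : X' * X = 1) (T N : F) :
    (X * G * X') * (X * G * X') - T • (X * G * X') + N • (1 : Matrix n n F) = X * (G * G - T • G + N • (1 : Matrix n n F)) * X' := by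
  have h1 : (X * G * X') * (X * G * X') = X * (G * G) * X' := by
    simp only [Matrix.mul_assoc]
    rw [← Matrix.mul_assoc X' X, hX'X, Matrix.one_mul]
  rw [h1, Matrix.mul_add, Matrix.mul_sub, Matrix.add_mul, Matrix.sub_mul, Matrix.mul_smul, Matrix.smul_mul, Matrix.mul_smul, Matrix.smul_mul, Matrix.mul_one, hXX']

/-- Entries of `X · diagonal(0,0,p) · X'`: `(X diag(0,0,p) X')_{il} = X_{i2} · p · X'_{2l}`. [folklore] -/
theorem conj_diagonal_two_apply (X X' : Matrix (Fin 3) (Fin 3) F) (p : F) (i l : Fin 3) :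
    (X * Matrix.diagonal ![0, 0, p] * X') i l = X i 2 * p * X' 2 l := by
  rw [Matrix.mul_apply, Fin.sum_univ_three]
  simp [Matrix.mul_diagonal]

/-- **`π(y)_{il} = π(c) · x_{i2} (x⁻¹)_{2l}`** for `y = x γ x⁻¹`, `γ = !![0, −N, 0; 1, T, 0; 0, 0, c]` — conjugating the projector `π(γ) = π(c) E₂₂`.
[cite: HarishChandra1970, Part VII §2 Theorem 18 p. 69] -/
theorem apply_mul_mul_inv_apply_two_eq {x γ : GL (Fin 3) F} {T N c : F} (hγ : (γ : Matrix (Fin 3) (Fin 3) F) = !![0, -N, 0; 1, T, 0; 0, 0, c]) (i l : Fin 3) :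
    (x : Matrix (Fin 3) (Fin 3) F) i 2 * (c ^ 2 - T * c + N) * ((x⁻¹ : GL (Fin 3) F) : Matrix (Fin 3) (Fin 3) F) 2 l =
      (((x * γ * x⁻¹ : GL (Fin 3) F) : Matrix (Fin 3) (Fin 3) F) * ((x * γ * x⁻¹ : GL (Fin 3) F) : Matrix (Fin 3) (Fin 3) F) -
        T • ((x * γ * x⁻¹ : GL (Fin 3) F) : Matrix (Fin 3) (Fin 3) F) + N • (1 : Matrix (Fin 3) (Fin 3) F)) i l := by
  have hXX' : (x : Matrix (Fin 3) (Fin 3) F) * ((x⁻¹ : GL (Fin 3) F) : Matrix (Fin 3) (Fin 3) F) = 1 := by rw [← Units.val_mul, mul_inv_cancel, Units.val_one]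
  have hX'X : ((x⁻¹ : GL (Fin 3) F) : Matrix (Fin 3) (Fin 3) F) * (x : Matrix (Fin 3) (Fin 3) F) = 1 := by rw [← Units.val_mul, inv_mul_cancel, Units.val_one]
  rw [Units.val_mul, Units.val_mul, conj_sq_sub_smul_add_smul_one _ _ _ hXX' hX'X, hγ, sq_sub_smul_add_smul_one_eq_diagonal, conj_diagonal_two_apply]

/-- **`tr(x γ x⁻¹) = T + c`**. [folklore] -/
theorem trace_conj_eq {x γ : GL (Fin 3) F} {T N c : F} (hγ : (γ : Matrix (Fin 3) (Fin 3) F) = !![0, -N, 0; 1, T, 0; 0, 0, c]) :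
    Matrix.trace (((x * γ * x⁻¹ : GL (Fin 3) F)) : Matrix (Fin 3) (Fin 3) F) = T + c := by
  have hX'X : ((x⁻¹ : GL (Fin 3) F) : Matrix (Fin 3) (Fin 3) F) * (x : Matrix (Fin 3) (Fin 3) F) = 1 := by rw [← Units.val_mul, inv_mul_cancel, Units.val_one]
  rw [Units.val_mul, Units.val_mul, Matrix.trace_mul_cycle, hX'X, Matrix.one_mul, hγ, Matrix.trace_fin_three]
  simp

/-- **`tr adj(x γ x⁻¹) = N + T c`** (the second coefficient of the characteristic polynomial; `adj(γ) = diag(c·adj C_π, det C_π)`). [folklore] -/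
theorem trace_adjugate_conj_eq {x γ : GL (Fin 3) F} {T N c : F} (hγ : (γ : Matrix (Fin 3) (Fin 3) F) = !![0, -N, 0; 1, T, 0; 0, 0, c]) :
    Matrix.trace (Matrix.adjugate (((x * γ * x⁻¹ : GL (Fin 3) F)) : Matrix (Fin 3) (Fin 3) F)) = N + T * c := by
  have hX'X : ((x⁻¹ : GL (Fin 3) F) : Matrix (Fin 3) (Fin 3) F) * (x : Matrix (Fin 3) (Fin 3) F) = 1 := by rw [← Units.val_mul, inv_mul_cancel, Units.val_one]
  rw [Units.val_mul, Units.val_mul, Matrix.adjugate_mul_distrib, Matrix.adjugate_mul_distrib, ← Matrix.mul_assoc, Matrix.trace_mul_cycle,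
    ← Matrix.adjugate_mul_distrib, hX'X, Matrix.adjugate_one, Matrix.one_mul, hγ, Matrix.adjugate_fin_three, Matrix.trace_fin_three]
  simp
  ring

/-- **The torus element `t(u,v) = diag(u + v C_π, 1)` commutes with `γ`**. [cite: HarishChandra1970, Part VII §2 Theorem 18 p. 69] -/
theorem blockT_mul_eq_mul_blockT (T N c u v : F) :
    !![u, -(v * N), 0; v, u + v * T, 0; 0, 0, 1] * !![0, -N, 0; 1, T, 0; 0, 0, c] = !![0, -N, 0; 1, T, 0; 0, 0, c] * !![u, -(v * N), 0; v, u + v * T, 0; 0, 0, 1] := by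
  ext i j
  fin_cases i <;> fin_cases j <;> simp <;> ring

/-- `det t(u,v) = u² + uvT + v²N` (the norm of `u + v e`). [folklore] -/
theorem det_blockT (T N u v : F) : (!![u, -(v * N), 0; v, u + v * T, 0; 0, 0, (1 : F)]).det = u ^ 2 + u * v * T + v ^ 2 * N := by
  rw [Matrix.det_fin_three]
  simp
  ring

/-- Entries of `X · t(u,v)`: row `i` of the block is the image `(a u + b v, b u + v(bT − aN))` of the row `(a, b) = (X_{i0}, X_{i1})` under `u + v C_π`, the third column is
unchanged. [folklore] -/
theorem mul_blockT_apply (X : Matrix (Fin 3) (Fin 3) F) (T N u v : F) (i : Fin 3) :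
    (X * !![u, -(v * N), 0; v, u + v * T, 0; 0, 0, 1]) i 0 = X i 0 * u + X i 1 * v ∧
      (X * !![u, -(v * N), 0; v, u + v * T, 0; 0, 0, 1]) i 1 = X i 1 * u + v * (X i 1 * T - X i 0 * N) ∧
      (X * !![u, -(v * N), 0; v, u + v * T, 0; 0, 0, 1]) i 2 = X i 2 := by
  refine ⟨?_, ?_, ?_⟩
  · rw [Matrix.mul_apply, Fin.sum_univ_three]; simp
  · rw [Matrix.mul_apply, Fin.sum_univ_three]; simp; ring
  · rw [Matrix.mul_apply, Fin.sum_univ_three]; simp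

/-- Rows `0, 1` of `γ · W` for `γ = !![0, −N, 0; 1, T, 0; 0, 0, c]`: `(γW)_{0l} = −N W_{1l}`, `(γW)_{1l} = W_{0l} + T W_{1l}`. [folklore] -/
theorem gamma_mul_apply (W : Matrix (Fin 3) (Fin 3) F) (T N c : F) (l : Fin 3) :
    (!![0, -N, 0; 1, T, 0; 0, 0, c] * W) 0 l = -(N * W 1 l) ∧ (!![0, -N, 0; 1, T, 0; 0, 0, c] * W) 1 l = W 0 l + T * W 1 l := by
  refine ⟨?_, ?_⟩ <;> rw [Matrix.mul_apply, Fin.sum_univ_three] <;> simp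

/-- **THE NORM FORM IS MULTIPLICATIVE**: `Q(r·(u + vC_π)) = (u² + uvT + v²N)·Q(r)` for `Q(a,b) = a(bT − aN) − b²` (`= det[r ; rC_π]`).
[cite: NeukirchANT1999, Ch. II §5] -/
theorem Q_rowAct (T N a b u v : F) :
    (a * u + b * v) * ((b * u + v * (b * T - a * N)) * T - (a * u + b * v) * N) - (b * u + v * (b * T - a * N)) * (b * u + v * (b * T - a * N)) =
      (u ^ 2 + u * v * T + v ^ 2 * N) * (a * (b * T - a * N) - b * b) := by
  ring

/-- **CRAMER**: for a row `r = (a,b)` with `Q(r) ≠ 0`, the element `u + vC_π` with `u = −b∕Q(r)`, `v = a∕Q(r)` sends `r` to `(0, 1)` and has `det = −1∕Q(r)`.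
[cite: NeukirchANT1999, Ch. II §5] -/
theorem rowAct_cramer {T N a b : F} (hQ : a * (b * T - a * N) - b * b ≠ 0) :
    a * (-b / (a * (b * T - a * N) - b * b)) + b * (a / (a * (b * T - a * N) - b * b)) = 0 ∧
      b * (-b / (a * (b * T - a * N) - b * b)) + (a / (a * (b * T - a * N) - b * b)) * (b * T - a * N) = 1 ∧
      (-b / (a * (b * T - a * N) - b * b)) ^ 2 + (-b / (a * (b * T - a * N) - b * b)) * (a / (a * (b * T - a * N) - b * b)) * T +
          (a / (a * (b * T - a * N) - b * b)) ^ 2 * N = -(a * (b * T - a * N) - b * b)⁻¹ := by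
  set q : F := a * (b * T - a * N) - b * b with hq
  refine ⟨?_, ?_, ?_⟩
  · rw [div_eq_mul_inv, div_eq_mul_inv]; ring
  · rw [div_eq_mul_inv, div_eq_mul_inv]
    have h : b * (-b * q⁻¹) + a * q⁻¹ * (b * T - a * N) = (a * (b * T - a * N) - b * b) * q⁻¹ := by ring
    rw [h, ← hq, mul_inv_cancel₀ hQ]
  · rw [div_eq_mul_inv, div_eq_mul_inv]
    have h : (-b * q⁻¹) ^ 2 + -b * q⁻¹ * (a * q⁻¹) * T + (a * q⁻¹) ^ 2 * N = -(((a * (b * T - a * N) - b * b) * q⁻¹) * q⁻¹) := by ring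
    rw [h, ← hq, mul_inv_cancel₀ hQ, one_mul]

end Algebra

/-! ## §2 Integrality consequences of `y = x γ x⁻¹ ∈ M₃(𝒪)` -/

section Integral

variable {F : Type*} [Field F] [Valued F ℤᵐ⁰]

/-- **`|c| ≤ 1`**: the third column of `x` is a `c`-eigenvector of the integral `y` (top entry of that column). [cite: HarishChandra1970, Part VII §2 Theorem 18 p. 69] -/
theorem v_c_le_one {x γ : GL (Fin 3) F} {T N c : F} (hγ : (γ : Matrix (Fin 3) (Fin 3) F) = !![0, -N, 0; 1, T, 0; 0, 0, c])
    (hy : ∀ i j, Valued.v ((((x * γ * x⁻¹ : GL (Fin 3) F)) : Matrix (Fin 3) (Fin 3) F) i j) ≤ 1) : Valued.v c ≤ 1 := by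
  set X : Matrix (Fin 3) (Fin 3) F := (x : Matrix (Fin 3) (Fin 3) F) with hX
  set Y : Matrix (Fin 3) (Fin 3) F := ((x * γ * x⁻¹ : GL (Fin 3) F) : Matrix (Fin 3) (Fin 3) F) with hY
  -- `X γ = Y X`, third column: `X_{i2} c = Σ_m Y_{im} X_{m2}`
  have hXG : X * (γ : Matrix (Fin 3) (Fin 3) F) = Y * X := by
    rw [hY, hX, ← Units.val_mul, ← Units.val_mul, inv_mul_cancel_right]
  have hcol : ∀ i, X i 2 * c = ∑ m, Y i m * X m 2 := by
    intro i
    have h := congrFun (congrFun hXG i) 2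
    rw [Matrix.mul_apply, Matrix.mul_apply, Fin.sum_univ_three, hγ] at h
    simp at h
    rw [← h]
  obtain ⟨i₁, hi₁⟩ := exists_apply_ne_zero_of_col x 2
  obtain ⟨i₀, -, hi₀⟩ := Finset.exists_max_image (Finset.univ : Finset (Fin 3)) (fun i => Valued.v (X i 2)) ⟨i₁, Finset.mem_univ _⟩
  have hγ0 : Valued.v (X i₀ 2) ≠ 0 := by
    intro h0
    have h1 := hi₀ i₁ (Finset.mem_univ _)
    rw [h0, le_zero_iff] at h1
    exact hi₁ ((Valuation.zero_iff _).1 h1)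
  have hle : Valued.v (X i₀ 2) * Valued.v c ≤ Valued.v (X i₀ 2) * 1 := by
    rw [mul_one, ← map_mul, hcol i₀]
    refine Valuation.map_sum_le _ fun m _ => ?_
    rw [map_mul]
    calc Valued.v (Y i₀ m) * Valued.v (X m 2) ≤ 1 * Valued.v (X i₀ 2) := mul_le_mul' (hy i₀ m) (hi₀ m (Finset.mem_univ _))
      _ = Valued.v (X i₀ 2) := one_mul _
  calc Valued.v c = (Valued.v (X i₀ 2))⁻¹ * (Valued.v (X i₀ 2) * Valued.v c) := by rw [inv_mul_cancel_left₀ hγ0]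
    _ ≤ (Valued.v (X i₀ 2))⁻¹ * (Valued.v (X i₀ 2) * 1) := mul_le_mul_right hle _
    _ = 1 := by rw [mul_one, inv_mul_cancel₀ hγ0]

/-- **`|T| ≤ 1`**: `T = tr y − c`. [cite: HarishChandra1970, Part VII §2 Theorem 18 p. 69] -/
theorem v_T_le_one {x γ : GL (Fin 3) F} {T N c : F} (hγ : (γ : Matrix (Fin 3) (Fin 3) F) = !![0, -N, 0; 1, T, 0; 0, 0, c])
    (hy : ∀ i j, Valued.v ((((x * γ * x⁻¹ : GL (Fin 3) F)) : Matrix (Fin 3) (Fin 3) F) i j) ≤ 1) : Valued.v T ≤ 1 := by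
  have htr := trace_conj_eq (x := x) hγ
  rw [Matrix.trace_fin_three] at htr
  have hT : T = (((x * γ * x⁻¹ : GL (Fin 3) F)) : Matrix (Fin 3) (Fin 3) F) 0 0 + (((x * γ * x⁻¹ : GL (Fin 3) F)) : Matrix (Fin 3) (Fin 3) F) 1 1 +
      (((x * γ * x⁻¹ : GL (Fin 3) F)) : Matrix (Fin 3) (Fin 3) F) 2 2 - c := by rw [htr, add_sub_cancel_right]
  rw [hT]
  refine (Valuation.map_sub _ _ _).trans (max_le ?_ (v_c_le_one hγ hy))
  exact Valuation.map_add_le _ (Valuation.map_add_le _ (hy 0 0) (hy 1 1)) (hy 2 2)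

/-- **`|N| ≤ 1`**: `N = tr adj(y) − Tc`, and the adjugate of an integral matrix is integral. [cite: HarishChandra1970, Part VII §2 Theorem 18 p. 69] -/
theorem v_N_le_one {x γ : GL (Fin 3) F} {T N c : F} (hγ : (γ : Matrix (Fin 3) (Fin 3) F) = !![0, -N, 0; 1, T, 0; 0, 0, c])
    (hy : ∀ i j, Valued.v ((((x * γ * x⁻¹ : GL (Fin 3) F)) : Matrix (Fin 3) (Fin 3) F) i j) ≤ 1) : Valued.v N ≤ 1 := by
  set Y : Matrix (Fin 3) (Fin 3) F := ((x * γ * x⁻¹ : GL (Fin 3) F) : Matrix (Fin 3) (Fin 3) F) with hY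
  have htr := trace_adjugate_conj_eq (x := x) hγ
  rw [Matrix.adjugate_fin_three, Matrix.trace_fin_three] at htr
  simp only [Matrix.of_apply, Matrix.cons_val', Matrix.cons_val_zero, Matrix.cons_val_one, Matrix.empty_val', Matrix.cons_val_fin_one,
    Matrix.cons_val_two, Matrix.tail_cons, Matrix.head_cons, Matrix.head_fin_const] at htr
  have hsub : ∀ p q r s : Fin 3, Valued.v (Y p q * Y r s - Y p s * Y r q) ≤ 1 := fun p q r s =>
    (Valuation.map_sub _ _ _).trans (max_le (by rw [map_mul]; exact mul_le_one' (hy p q) (hy r s)) (by rw [map_mul]; exact mul_le_one' (hy p s) (hy r q)))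
  have hN : N = (Y 1 1 * Y 2 2 - Y 1 2 * Y 2 1 + (Y 0 0 * Y 2 2 - Y 0 2 * Y 2 0) + (Y 0 0 * Y 1 1 - Y 0 1 * Y 1 0)) - T * c := by
    rw [htr, add_sub_cancel_right]
  rw [hN]
  refine (Valuation.map_sub _ _ _).trans (max_le ?_ ?_)
  · exact Valuation.map_add_le _ (Valuation.map_add_le _ (hsub 1 1 2 2) (hsub 0 0 2 2)) (hsub 0 0 1 1)
  · rw [map_mul]; exact mul_le_one' (v_T_le_one hγ hy) (v_c_le_one hγ hy)

/-- **`|π(c) · x_{i2} (x⁻¹)_{2l}| ≤ 1`** for `y = x γ x⁻¹` integral: `π(y) = y² − Ty + N` is integral. [cite: HarishChandra1970, Part VII §2 Theorem 18 p. 69] -/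
theorem v_evalc_mul_apply_mul_inv_apply_le_one {x γ : GL (Fin 3) F} {T N c : F} (hγ : (γ : Matrix (Fin 3) (Fin 3) F) = !![0, -N, 0; 1, T, 0; 0, 0, c])
    (hy : ∀ i j, Valued.v ((((x * γ * x⁻¹ : GL (Fin 3) F)) : Matrix (Fin 3) (Fin 3) F) i j) ≤ 1) (i l : Fin 3) :
    Valued.v ((c ^ 2 - T * c + N) * ((x : Matrix (Fin 3) (Fin 3) F) i 2 * ((x⁻¹ : GL (Fin 3) F) : Matrix (Fin 3) (Fin 3) F) 2 l)) ≤ 1 := by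
  have heq : (c ^ 2 - T * c + N) * ((x : Matrix (Fin 3) (Fin 3) F) i 2 * ((x⁻¹ : GL (Fin 3) F) : Matrix (Fin 3) (Fin 3) F) 2 l) =
      (x : Matrix (Fin 3) (Fin 3) F) i 2 * (c ^ 2 - T * c + N) * ((x⁻¹ : GL (Fin 3) F) : Matrix (Fin 3) (Fin 3) F) 2 l := by ring
  rw [heq, apply_mul_mul_inv_apply_two_eq hγ, Matrix.add_apply, Matrix.sub_apply, Matrix.smul_apply, Matrix.smul_apply, smul_eq_mul, smul_eq_mul]
  refine Valuation.map_add_le _ ((Valuation.map_sub _ _ _).trans (max_le (v_mul_apply_le_one hy hy i l) ?_)) ?_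
  · rw [map_mul]; exact mul_le_one' (v_T_le_one hγ hy) (hy i l)
  · rw [map_mul]
    refine mul_le_one' (v_N_le_one hγ hy) ?_
    by_cases hil : i = l
    · subst hil; rw [Matrix.one_apply_eq, map_one]
    · rw [Matrix.one_apply_ne hil, map_zero]; exact zero_le

end Integral

/-! ## §3 The anisotropy bound in valuation form -/

section Anisotropy

variable {F : Type*} [Field F] [Valued F ℤᵐ⁰] [ValuativeRel F] [(Valued.v : Valuation F ℤᵐ⁰).Compatible] [IsNonarchimedeanLocalField F]

/-- `‖x‖ ≤ ‖y‖ ⇒ |x| ≤ |y|` (the normalised absolute value is increasing in the valuation). [folklore] -/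
theorem v_le_of_normAbs_le {a b : F} (h : normAbs F a ≤ normAbs F b) : Valued.v a ≤ Valued.v b := by
  rw [normAbs_apply, normAbs_apply, (WithZeroMulInt.toNNReal_strictMono (by exact_mod_cast one_lt_residueFieldCard F)).le_iff_le, map_le_map_iff] at h
  exact (v_le_iff_valuation_le a b).2 h

/-- **THE ANISOTROPY BOUND** (homogenised ★ `normAbs_discr_mul_max_le`, i.e. Hensel): for `π = X² − TX + N` with integral coefficients and NO root in `F`, the norm form
`Q(a,b) = a(bT − aN) − b²` satisfies `|T² − 4N|·|a|² ≤ |Q(a,b)|` and `|T² − 4N|·|b|² ≤ |Q(a,b)|`. [cite: NeukirchANT1999, Ch. II §4 Lemma (4.6)]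
[cite: HarishChandra1970, Part VII §3 Lemma 46 p. 73] -/
theorem v_discr_mul_sq_le_v_normForm {T N : F} (hπ : ∀ r : F, r ^ 2 - T * r + N ≠ 0) (hT : Valued.v T ≤ 1) (hN : Valued.v N ≤ 1) (a b : F) :
    Valued.v ((T ^ 2 - 4 * N) * a ^ 2) ≤ Valued.v (a * (b * T - a * N) - b * b) ∧
      Valued.v ((T ^ 2 - 4 * N) * b ^ 2) ≤ Valued.v (a * (b * T - a * N) - b * b) := by
  -- the normalised-absolute-value form of the coefficients' integrality
  have hT' : normAbs F T ≤ 1 := normAbs_le_one_iff.2 ((v_le_one_iff_mem_integer T).1 hT)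
  have hN' : normAbs F N ≤ 1 := normAbs_le_one_iff.2 ((v_le_one_iff_mem_integer N).1 hN)
  have hM : max 1 (max (normAbs F T) (normAbs F N)) = 1 := max_eq_left (max_le hT' hN')
  by_cases ha : a = 0
  · subst ha
    have hQ : (0 : F) * (b * T - 0 * N) - b * b = -(b ^ 2) := by ring
    have h4 : Valued.v (4 : F) ≤ 1 := by
      have h4eq : (4 : F) = 1 + 1 + 1 + 1 := by norm_num
      rw [h4eq]
      exact Valuation.map_add_le _ (Valuation.map_add_le _ (Valuation.map_add_le _ (map_one Valued.v).le (map_one Valued.v).le) (map_one Valued.v).le)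
        (map_one Valued.v).le
    have hD1 : Valued.v (T ^ 2 - 4 * N) ≤ 1 := by
      refine (Valuation.map_sub _ _ _).trans (max_le ?_ ?_)
      · rw [map_pow]; exact pow_le_one' hT _
      · rw [map_mul]; exact mul_le_one' h4 hN
    refine ⟨?_, ?_⟩
    · rw [zero_pow two_ne_zero, mul_zero, map_zero]; exact zero_le
    · rw [hQ, Valuation.map_neg, map_mul]
      exact mul_le_of_le_one_left' hD1
  · -- homogenise: `Q(a,b) = −a² π(b∕a)`
    have hQ : a * (b * T - a * N) - b * b = -(a ^ 2 * ((b / a) ^ 2 - T * (b / a) + N)) := by field_simp; ring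
    have han := K2E3GL2EllipticConjugacyCount.normAbs_discr_mul_max_le hπ (b / a)
    rw [hM, one_pow, one_mul] at han
    have ha' : 0 < normAbs F a := pos_iff_ne_zero.2 ((map_ne_zero (normAbs F)).2 ha)
    -- `‖D‖·‖a‖² ≤ ‖Q‖` and `‖D‖·‖b‖² ≤ ‖Q‖`
    have hQn : normAbs F (a * (b * T - a * N) - b * b) = normAbs F a ^ 2 * normAbs F ((b / a) ^ 2 - T * (b / a) + N) := by
      rw [hQ]
      have : normAbs F (-(a ^ 2 * ((b / a) ^ 2 - T * (b / a) + N))) = normAbs F (a ^ 2 * ((b / a) ^ 2 - T * (b / a) + N)) := by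
        rw [normAbs_apply, normAbs_apply, Valuation.map_neg]
      rw [this, map_mul, map_pow]
    have h1 : normAbs F ((T ^ 2 - 4 * N) * a ^ 2) ≤ normAbs F (a * (b * T - a * N) - b * b) := by
      rw [map_mul, map_pow, hQn, mul_comm]
      exact mul_le_mul_right ((le_mul_of_one_le_right zero_le (le_max_left _ _)).trans han) _
    have h2 : normAbs F ((T ^ 2 - 4 * N) * b ^ 2) ≤ normAbs F (a * (b * T - a * N) - b * b) := by
      have hb : normAbs F (b ^ 2) = normAbs F a ^ 2 * normAbs F (b / a) ^ 2 := by
        rw [← mul_pow, ← map_mul, mul_div_cancel₀ b ha, map_pow]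
      rw [map_mul, hb, hQn, ← mul_assoc, mul_comm (normAbs F (T ^ 2 - 4 * N)), mul_assoc]
      exact mul_le_mul_right ((mul_le_mul_right (le_max_right _ _) _).trans han) _
    exact ⟨v_le_of_normAbs_le h1, v_le_of_normAbs_le h2⟩

end Anisotropy

end Summit.HodgeConjecture.HodgeConjecture.Cruxes.H413.K2E3GL3MixedTorusNormForm

end
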